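import Summits.QuantumFields.YangMills.Theorems.BalabanLadderNTReferencePackageScales
import Summits.QuantumFields.YangMills.Theorems.BalabanLadderNTBoundaryLawOscillation
import HarnessLib

/-!
# Crux `NT` (stmt-QuantumFields-19353): reference-state transfer, IV — clause (i) of `LowerBounds` from the
# one/two-point exterior-oscillation ceilings and a two-point floor WITH MARGIN in ONE reference state

Helper file (`--supports stmt-QuantumFields-19353`) of the fleet lead prover of crux `NT` (unit `ym-spine-19353-p1`,
g4): the two-point half of the sorried composition `lowerBounds_of_refPackage` of the crux idea
`Cruxes/NT/Ideas/reference-state-transfer.md` (crux-ideate seat `ym-cruxidea-19353-1`, g3), kernel-checked, with the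
reference exterior ARBITRARY (`ηr β`; the card's cold wall `fun _ => 1` is one choice) and the sharper margin
`2 h h' + ω` of the oscillation-form law of total covariance (sibling file I) in place of the card's `8 h h' + ω`.

`lowerBounds_fst_of_reference`: for a unit map `a` (`0 < a`, `a → 0`) suppose, with constants `C₁, C₂ ≥ 0`, a femto
scale `ℓ`, a reference radius `ρ`, a support radius `σ` and a collar `κ` (`0 < σ`, `0 < κ`, `2(σ+κ) < ℓ`, `σ + κ < ρ`):
* (E1-osc) on femto cubes (`b · a β ≤ ℓ`, `β ≥ β₁`) the kernel mean of the action density at a site of depth `d ≥ 1`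
  oscillates over exteriors by at most `C₁ / d⁴`;
* (E2-osc) likewise the kernel covariance of two action densities at depths `≥ d` oscillates by at most
  `C₂ / d⁴ / (1 + ‖y − x‖)⁴`;
* (R2) ONE positive-time test function `v` supported in the ball of radius `σ` whose reflected smeared two-point
  function in the REFERENCE STATE (the kernel of the origin-centred cube of lattice radius `⌈ρ / a β⌉₊` with exterior
  `ηr β`) beats `ε` plus the explicit transfer margin `2 h_{θv} h_v + w_{θv,v}` for all large `β`, where
  `h_f = C₁ (aβ/κ)⁴ Σ_x |f(aβ x)|`, `w_{f,g} = C₂ (aβ/κ)⁴ Σ_{x,y} |f(aβ x)| |g(aβ y)| / (1 + ‖y−x‖)⁴` (sums over the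
  reference box).
Then clause (i) of `LowerBounds G r a` holds with the same `v, ε` and `Λ₅ = σ + κ + 1`: on EVERY torus `2L+1` with
`a β · L ≥ Λ₅`, `Q2_{β,L,aβ}(θv, v) ≥ ε`.  Proof: per pair of support sites the reference-state transfer
`Reference.abs_torusCov_dens_sub_kerCov_dens_le` (file II) through the transfer cube of radius `⌈(σ+κ)/aβ⌉₊ + 1`
(scales: file III), summed with the weights `|θv(aβ x)| |v(aβ y)|`.

Refs: card `Cruxes/NT/Ideas/reference-state-transfer.md` (§Mechanism 1–3, D4 `RefFloor2`, `lowerBounds_of_refPackage`).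
-/

set_option autoImplicit false

noncomputable section

open scoped SchwartzMap
open MeasureTheory Filter Topology
open Literature.MathematicalPhysics.QuantumFieldTheory Literature.MathematicalPhysics.QuantumLattice
open Literature.Probability.LatticeModels
open Summit.QuantumFields.YangMills.Cruxes.OSLegsFromFemtoAndGap.DlrCollarTransfer
open Summit.QuantumFields.YangMills.Cruxes.NT.BoundaryLaw (cubeEdges_centred_subset)

namespace Summit.QuantumFields.YangMills.Cruxes.NT.Reference

/-! ## §1 Weighted double sums -/

/-- `Σ_x Σ_y A_x B_y (c + w_{xy}) = c (Σ A)(Σ B) + Σ_x Σ_y A_x B_y w_{xy}`. [folklore] -/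
theorem sum_sum_mul_add {ι : Type*} (s : Finset ι) (A B : ι → ℝ) (w : ι → ι → ℝ) (c : ℝ) :
    ∑ x ∈ s, ∑ y ∈ s, A x * B y * (c + w x y) =
      c * ((∑ x ∈ s, A x) * ∑ y ∈ s, B y) + ∑ x ∈ s, ∑ y ∈ s, A x * B y * w x y := by
  rw [Finset.sum_mul_sum, Finset.mul_sum, ← Finset.sum_add_distrib]
  refine Finset.sum_congr rfl fun x _ => ?_
  rw [Finset.mul_sum, ← Finset.sum_add_distrib]
  refine Finset.sum_congr rfl fun y _ => ?_
  ring

/-- **Summing a per-pair two-sided transfer bound with weights.**  If `|t_{xy} − u_{xy}| ≤ c + w_{xy}` on `s × s`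
then `Σ f_x g_y u_{xy} − Σ f_x g_y t_{xy} ≤ c (Σ|f|)(Σ|g|) + Σ |f_x| |g_y| w_{xy}`. [folklore] -/
theorem sum_sum_sub_le_of_abs_sub_le {ι : Type*} (s : Finset ι) (f g : ι → ℝ) (t u w : ι → ι → ℝ) (c : ℝ)
    (h : ∀ x ∈ s, ∀ y ∈ s, |t x y - u x y| ≤ c + w x y) :
    ∑ x ∈ s, ∑ y ∈ s, f x * g y * u x y - ∑ x ∈ s, ∑ y ∈ s, f x * g y * t x y ≤
      c * ((∑ x ∈ s, |f x|) * ∑ y ∈ s, |g y|) + ∑ x ∈ s, ∑ y ∈ s, |f x| * |g y| * w x y := by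
  rw [← sum_sum_mul_add, ← Finset.sum_sub_distrib]
  refine Finset.sum_le_sum fun x hx => ?_
  rw [← Finset.sum_sub_distrib]
  refine Finset.sum_le_sum fun y hy => ?_
  have e : f x * g y * u x y - f x * g y * t x y = f x * g y * (u x y - t x y) := by ring
  rw [e]
  refine (le_abs_self _).trans ?_
  rw [abs_mul, abs_mul, abs_sub_comm]
  exact mul_le_mul_of_nonneg_left (h x hx y hy) (mul_nonneg (abs_nonneg _) (abs_nonneg _))

/-! ## §2 Clause (i) of `LowerBounds` from the reference package -/

section Main

variable (G : Type) [Group G] [TopologicalSpace G] [IsTopologicalGroup G] [CompactSpace G]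
  [MeasurableSpace G] [BorelSpace G] (r : LatticeRep G)

/-- **Per-pair transfer at coupling `β`.**  Transfer cube `P` (origin-centred, radius `RP`) inside the reference cube
(radius `R`), femto for (E1-osc)/(E2-osc) at `β`, a torus `2L+1 ⊇ P`; for sites `x, y` of the support box (depth
`≥ κ/α`, `≥ 1` in `P`): `|torusCov_L(dens x, dens y) − kerCov_ref(dens x, dens y)| ≤ 2 (C₁ (α/κ)⁴)² +
C₂ (α/κ)⁴ / (1 + ‖y − x‖)⁴`. [folklore] -/
theorem pair_transfer (β : ℝ) {C₁ C₂ ℓ κ α : ℝ} (hC₁ : 0 ≤ C₁) (hC₂ : 0 ≤ C₂) (hκ : 0 < κ) (hα : 0 < α)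
    {RP R L N : ℕ} (hRPR : RP ≤ R) (hfem : ((2 * RP + 1 : ℕ) : ℝ) * α ≤ ℓ) (hL : 2 * RP + 1 + 3 ≤ 2 * L + 1)
    (hdep : ∀ x ∈ box 4 N, κ / α ≤ (depth (fun _ => -(RP : ℤ)) (2 * RP + 1) x : ℝ) ∧
      1 ≤ depth (fun _ => -(RP : ℤ)) (2 * RP + 1) x)
    (H1 : ∀ (c : Fin 4 → ℤ) (b : ℕ), (b : ℝ) * α ≤ ℓ → ∀ (η η' : LGConfig 4 G) (x : Fin 4 → ℤ), 1 ≤ depth c b x →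
      |kerE G r β c b η (dens G r x) - kerE G r β c b η' (dens G r x)| ≤ C₁ / (depth c b x : ℝ) ^ 4)
    (H2 : ∀ (c : Fin 4 → ℤ) (b : ℕ), (b : ℝ) * α ≤ ℓ → ∀ (η η' : LGConfig 4 G) (x y : Fin 4 → ℤ),
      1 ≤ depth c b x → 1 ≤ depth c b y →
        |kerCov G r β c b η (dens G r x) (dens G r y) - kerCov G r β c b η' (dens G r x) (dens G r y)| ≤
          C₂ / ((min (depth c b x) (depth c b y) : ℕ) : ℝ) ^ 4 / (1 + ‖siteToE (y - x)‖) ^ 4)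
    (η₀ : LGConfig 4 G) {x y : Fin 4 → ℤ} (hx : x ∈ box 4 N) (hy : y ∈ box 4 N) :
    |(torusE G r β L (fun U => dens G r x U * dens G r y U) - torusE G r β L (dens G r x) * torusE G r β L (dens G r y))
      - kerCov G r β (fun _ => -(R : ℤ)) (2 * R + 1) η₀ (dens G r x) (dens G r y)| ≤
      2 * (C₁ * (α / κ) ^ 4) * (C₁ * (α / κ) ^ 4) + C₂ * (α / κ) ^ 4 / (1 + ‖siteToE (y - x)‖) ^ 4 := by
  have hsub := cubeEdges_centred_subset hRPR
  obtain ⟨hxκ, hx1⟩ := hdep x hx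
  obtain ⟨hyκ, hy1⟩ := hdep y hy
  have hox : ∀ ζ ζ', |kerE G r β (fun _ => -(RP : ℤ)) (2 * RP + 1) ζ (dens G r x) -
      kerE G r β (fun _ => -(RP : ℤ)) (2 * RP + 1) ζ' (dens G r x)| ≤ C₁ * (α / κ) ^ 4 := fun ζ ζ' =>
    (H1 _ _ hfem ζ ζ' x hx1).trans (div_pow_depth_le hC₁ hκ hα hxκ)
  have hoy : ∀ ζ ζ', |kerE G r β (fun _ => -(RP : ℤ)) (2 * RP + 1) ζ (dens G r y) -
      kerE G r β (fun _ => -(RP : ℤ)) (2 * RP + 1) ζ' (dens G r y)| ≤ C₁ * (α / κ) ^ 4 := fun ζ ζ' =>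
    (H1 _ _ hfem ζ ζ' y hy1).trans (div_pow_depth_le hC₁ hκ hα hyκ)
  have hpos : 0 < (1 + ‖siteToE (y - x)‖) ^ 4 := by positivity
  have hmin : κ / α ≤ ((min (depth (fun _ => -(RP : ℤ)) (2 * RP + 1) x)
      (depth (fun _ => -(RP : ℤ)) (2 * RP + 1) y) : ℕ) : ℝ) := by
    rw [Nat.cast_min]; exact le_min hxκ hyκ
  have hoC : ∀ ζ ζ', |kerCov G r β (fun _ => -(RP : ℤ)) (2 * RP + 1) ζ (dens G r x) (dens G r y) -
      kerCov G r β (fun _ => -(RP : ℤ)) (2 * RP + 1) ζ' (dens G r x) (dens G r y)| ≤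
      C₂ * (α / κ) ^ 4 / (1 + ‖siteToE (y - x)‖) ^ 4 := fun ζ ζ' =>
    (H2 _ _ hfem ζ ζ' x y hx1 hy1).trans
      (div_le_div_of_nonneg_right (div_pow_depth_le hC₂ hκ hα hmin) hpos.le)
  exact abs_torusCov_dens_sub_kerCov_dens_le G r β hsub η₀ L hL hx1 hy1 hox hoy hoC

/-- **Clause (i) of `LowerBounds` from the reference package (two-point half of the card's
`lowerBounds_of_refPackage`, reference exterior arbitrary).**  See the module docstring. [folklore] -/
theorem lowerBounds_fst_of_reference (a : ℝ → ℝ) (ha₀ : ∀ β, 0 < a β) (ha : Tendsto a atTop (𝓝 0))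
    {C₁ C₂ ℓ ρ σ κ : ℝ} (hC₁ : 0 ≤ C₁) (hC₂ : 0 ≤ C₂) (hσ : 0 < σ) (hκ : 0 < κ)
    (hℓ : 2 * (σ + κ) < ℓ) (hρ : σ + κ < ρ) (ηr : ℝ → LGConfig 4 G)
    (hE1 : ∃ β₁ : ℝ, ∀ β : ℝ, β₁ ≤ β → ∀ (c : Fin 4 → ℤ) (b : ℕ), (b : ℝ) * a β ≤ ℓ →
      ∀ (η η' : LGConfig 4 G) (x : Fin 4 → ℤ), 1 ≤ depth c b x →
        |kerE G r β c b η (dens G r x) - kerE G r β c b η' (dens G r x)| ≤ C₁ / (depth c b x : ℝ) ^ 4)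
    (hE2 : ∃ β₂ : ℝ, ∀ β : ℝ, β₂ ≤ β → ∀ (c : Fin 4 → ℤ) (b : ℕ), (b : ℝ) * a β ≤ ℓ →
      ∀ (η η' : LGConfig 4 G) (x y : Fin 4 → ℤ), 1 ≤ depth c b x → 1 ≤ depth c b y →
        |kerCov G r β c b η (dens G r x) (dens G r y) - kerCov G r β c b η' (dens G r x) (dens G r y)| ≤
          C₂ / ((min (depth c b x) (depth c b y) : ℕ) : ℝ) ^ 4 / (1 + ‖siteToE (y - x)‖) ^ 4)
    (hR2 : ∃ (v : 𝓢(EuclideanSpace ℝ (Fin 4), ℝ)) (ε β₅ : ℝ),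
      tsupport (v : EuclideanSpace ℝ (Fin 4) → ℝ) ⊆ {y | 0 < y 0} ∧
      tsupport (v : EuclideanSpace ℝ (Fin 4) → ℝ) ⊆ Metric.closedBall 0 σ ∧ 0 < ε ∧
      ∀ β : ℝ, β₅ ≤ β →
        ε + 2 * (C₁ * (a β / κ) ^ 4 * ∑ x ∈ box 4 ⌈ρ / a β⌉₊, |thetaTest 4 v (a β • siteToE x)|) *
              (C₁ * (a β / κ) ^ 4 * ∑ y ∈ box 4 ⌈ρ / a β⌉₊, |v (a β • siteToE y)|) +
            C₂ * (a β / κ) ^ 4 * ∑ x ∈ box 4 ⌈ρ / a β⌉₊, ∑ y ∈ box 4 ⌈ρ / a β⌉₊,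
              |thetaTest 4 v (a β • siteToE x)| * |v (a β • siteToE y)| / (1 + ‖siteToE (y - x)‖) ^ 4 ≤
          ∑ x ∈ box 4 ⌈ρ / a β⌉₊, ∑ y ∈ box 4 ⌈ρ / a β⌉₊,
            thetaTest 4 v (a β • siteToE x) * v (a β • siteToE y) *
              kerCov G r β (fun _ => -(⌈ρ / a β⌉₊ : ℤ)) (2 * ⌈ρ / a β⌉₊ + 1) (ηr β) (dens G r x) (dens G r y)) :
    ∃ (v : 𝓢(EuclideanSpace ℝ (Fin 4), ℝ)) (ε β₅ Λ₅ : ℝ),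
      tsupport (v : EuclideanSpace ℝ (Fin 4) → ℝ) ⊆ {y : EuclideanSpace ℝ (Fin 4) | 0 < y 0} ∧ 0 < ε ∧
      ∀ β : ℝ, β₅ ≤ β → ∀ L : ℕ, Λ₅ ≤ a β * L → ε ≤ Q2 G r β L (a β) (thetaTest 4 v) v := by
  obtain ⟨β₁, H1⟩ := hE1
  obtain ⟨β₂, H2⟩ := hE2
  obtain ⟨v, ε, β₅, hvpos, hvσ, hε, HR⟩ := hR2
  -- smallness of the spacing
  have hδ : 0 < min (min (1 / 4 : ℝ) ((ρ - σ - κ) / 2)) ((ℓ - 2 * (σ + κ)) / 5) :=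
    lt_min (lt_min (by norm_num) (by linarith)) (by linarith)
  obtain ⟨βa, Ha⟩ := eventually_le_of_tendsto ha hδ
  refine ⟨v, ε, max (max β₅ βa) (max β₁ β₂), σ + κ + 1, hvpos, hε, fun β hβ L hL => ?_⟩
  have hβ₅ : β₅ ≤ β := le_trans (le_max_left _ _) (le_trans (le_max_left _ _) hβ)
  have hβa : βa ≤ β := le_trans (le_max_right _ _) (le_trans (le_max_left _ _) hβ)
  have hβ₁ : β₁ ≤ β := le_trans (le_max_left _ _) (le_trans (le_max_right _ _) hβ)
  have hβ₂ : β₂ ≤ β := le_trans (le_max_right _ _) (le_trans (le_max_right _ _) hβ)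
  have hα : 0 < a β := ha₀ β
  have hsmall := Ha β hβa
  have h4 : a β ≤ 1 / 4 := hsmall.trans ((min_le_left _ _).trans (min_le_left _ _))
  have hρ' : a β ≤ (ρ - σ - κ) / 2 := hsmall.trans ((min_le_left _ _).trans (min_le_right _ _))
  have hℓ' : a β ≤ (ℓ - 2 * (σ + κ)) / 5 := hsmall.trans (min_le_right _ _)
  obtain ⟨hRPR, hfem, hLL, hNL, hNR, hdep⟩ := scales hα hσ hκ h4 hρ' hℓ' hL (RP := ⌈(σ + κ) / a β⌉₊ + 1) rfl
  have HRβ := HR β hβ₅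
  -- notation (introduced after `HRβ`, so that it is rewritten too)
  set N := ⌈σ / a β⌉₊ with hN
  set R := ⌈ρ / a β⌉₊ with hR
  have hθ0 : ∀ x, x ∉ box 4 N → thetaTest 4 v (a β • siteToE x) = 0 := fun x hx =>
    thetaTest_smul_siteToE_eq_zero hα hvσ hx
  have hw0 : ∀ y, y ∉ box 4 N → v (a β • siteToE y) = 0 := fun y hy =>
    apply_smul_siteToE_eq_zero hα hvσ hy
  -- per-pair transfer
  have hpair : ∀ x ∈ box 4 N, ∀ y ∈ box 4 N,
      |(torusE G r β L (fun U => dens G r x U * dens G r y U) - torusE G r β L (dens G r x) * torusE G r β L (dens G r y))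
        - kerCov G r β (fun _ => -(R : ℤ)) (2 * R + 1) (ηr β) (dens G r x) (dens G r y)| ≤
      2 * (C₁ * (a β / κ) ^ 4) * (C₁ * (a β / κ) ^ 4) + C₂ * (a β / κ) ^ 4 / (1 + ‖siteToE (y - x)‖) ^ 4 :=
    fun x hx y hy => pair_transfer G r β hC₁ hC₂ hκ hα hRPR hfem hLL hdep (H1 β hβ₁) (H2 β hβ₂) (ηr β) hx hy
  -- the sums restricted to the support box
  have eQ : Q2 G r β L (a β) (thetaTest 4 v) v = ∑ x ∈ box 4 N, ∑ y ∈ box 4 N,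
      thetaTest 4 v (a β • siteToE x) * v (a β • siteToE y) *
        (torusE G r β L (fun U => dens G r x U * dens G r y U) -
          torusE G r β L (dens G r x) * torusE G r β L (dens G r y)) := by
    unfold Q2
    exact sum_box₂_eq hNL _ (fun x hx y => by rw [hθ0 x hx]; ring) (fun y hy x => by rw [hw0 y hy]; ring)
  have eR : ∑ x ∈ box 4 R, ∑ y ∈ box 4 R, thetaTest 4 v (a β • siteToE x) * v (a β • siteToE y) *
      kerCov G r β (fun _ => -(R : ℤ)) (2 * R + 1) (ηr β) (dens G r x) (dens G r y) =
      ∑ x ∈ box 4 N, ∑ y ∈ box 4 N, thetaTest 4 v (a β • siteToE x) * v (a β • siteToE y) *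
      kerCov G r β (fun _ => -(R : ℤ)) (2 * R + 1) (ηr β) (dens G r x) (dens G r y) :=
    sum_box₂_eq hNR _ (fun x hx y => by rw [hθ0 x hx]; ring) (fun y hy x => by rw [hw0 y hy]; ring)
  have e1 : ∑ x ∈ box 4 R, |thetaTest 4 v (a β • siteToE x)| = ∑ x ∈ box 4 N, |thetaTest 4 v (a β • siteToE x)| :=
    sum_box_eq_sum_box hNR _ fun x hx => by rw [hθ0 x hx, abs_zero]
  have e2 : ∑ y ∈ box 4 R, |v (a β • siteToE y)| = ∑ y ∈ box 4 N, |v (a β • siteToE y)| :=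
    sum_box_eq_sum_box hNR _ fun y hy => by rw [hw0 y hy, abs_zero]
  have e3 : ∑ x ∈ box 4 R, ∑ y ∈ box 4 R,
      |thetaTest 4 v (a β • siteToE x)| * |v (a β • siteToE y)| / (1 + ‖siteToE (y - x)‖) ^ 4 =
      ∑ x ∈ box 4 N, ∑ y ∈ box 4 N,
      |thetaTest 4 v (a β • siteToE x)| * |v (a β • siteToE y)| / (1 + ‖siteToE (y - x)‖) ^ 4 :=
    sum_box₂_eq hNR _ (fun x hx y => by rw [hθ0 x hx, abs_zero, zero_mul, zero_div])
      (fun y hy x => by rw [hw0 y hy, abs_zero, mul_zero, zero_div])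
  -- the weighted sum of the per-pair bounds
  have hsum := sum_sum_sub_le_of_abs_sub_le (box 4 N) (fun x => thetaTest 4 v (a β • siteToE x))
    (fun y => v (a β • siteToE y))
    (fun x y => torusE G r β L (fun U => dens G r x U * dens G r y U) -
      torusE G r β L (dens G r x) * torusE G r β L (dens G r y))
    (fun x y => kerCov G r β (fun _ => -(R : ℤ)) (2 * R + 1) (ηr β) (dens G r x) (dens G r y))
    (fun x y => C₂ * (a β / κ) ^ 4 / (1 + ‖siteToE (y - x)‖) ^ 4)
    (2 * (C₁ * (a β / κ) ^ 4) * (C₁ * (a β / κ) ^ 4)) hpair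
  have e4 : ∑ x ∈ box 4 N, ∑ y ∈ box 4 N, |thetaTest 4 v (a β • siteToE x)| * |v (a β • siteToE y)| *
      (C₂ * (a β / κ) ^ 4 / (1 + ‖siteToE (y - x)‖) ^ 4) =
      C₂ * (a β / κ) ^ 4 * ∑ x ∈ box 4 N, ∑ y ∈ box 4 N,
        |thetaTest 4 v (a β • siteToE x)| * |v (a β • siteToE y)| / (1 + ‖siteToE (y - x)‖) ^ 4 := by
    rw [Finset.mul_sum]
    refine Finset.sum_congr rfl fun x _ => ?_
    rw [Finset.mul_sum]
    refine Finset.sum_congr rfl fun y _ => ?_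
    ring
  rw [eR, e1, e2, e3] at HRβ
  rw [e4] at hsum
  rw [eQ]
  have hprod : 2 * (C₁ * (a β / κ) ^ 4 * ∑ x ∈ box 4 N, |thetaTest 4 v (a β • siteToE x)|) *
      (C₁ * (a β / κ) ^ 4 * ∑ y ∈ box 4 N, |v (a β • siteToE y)|) =
      2 * (C₁ * (a β / κ) ^ 4) * (C₁ * (a β / κ) ^ 4) *
        ((∑ x ∈ box 4 N, |thetaTest 4 v (a β • siteToE x)|) * ∑ y ∈ box 4 N, |v (a β • siteToE y)|) := by ring
  linarith [hsum, HRβ, hprod]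

end Main

end Summit.QuantumFields.YangMills.Cruxes.NT.Reference

end
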